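import Literature.AlgebraicGeometry.Motives.IntegralModelReductionSurjectiveOnClosedPoints
import Literature.AlgebraicGeometry.Motives.IntegralModelReductionMapFrobenius
import Literature.AlgebraicGeometry.Motives.GeometricPointsOverClosedPoints
import Mathlib.AlgebraicGeometry.Morphisms.Flat
import Mathlib.AlgebraicGeometry.Morphisms.Smooth
import HarnessLib

/-!
# The reduction map of a PROPER FLAT model is SURJECTIVE onto the geometric points of the special fibre
# ([Liu2002] Cor. 10.1.38 + [SerreTate1968] §1 Lemma 2: closed points, then the Frobenius orbit over a closed point)

Topic `Literature/AlgebraicGeometry/Motives`; namespace `Literature.AlgebraicGeometry.Motives.IntegralModel`.  THEOREMS ONLY (no definition,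
no named fact, no instance, no notation, no `sorry`).  Cell `hodgecm-mathlib` (D-0151), FLOOR-0 programme P5a (D9op), ED. 4 of
`Cruxes/HLiu418/Lines/F0_D9opRoad2.lean`: this file is piece **(b3b)** of road (b) and CLOSES the registered letter
`stub_H : ProperFlatModelReductionSurjective` («for every number field `K`, finite place `v`, `K`-scheme `X` and PROPER FLAT integral model `𝒳`
of `X` over `𝓞_{K,(v)}`, the reduction map `red_𝒳 : X(\overline{K_v}) → 𝒳_v(κ̄(v))` (★ `IntegralModel.geomReductionMap`) is surjective») —
`properFlatModelReductionSurjective` below has the letter's binders token for token.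

ROUTE.  Given a `κ̄(v)`-point `z` of `𝒳_v`:
(1) ★ (b3a) `IntegralModel.exists_geomReductionMap_pt_eq` ([Liu2002] Cor. 10.1.38 «`X⁰ → 𝒳_s` is surjective onto the closed points»):
    some `x ∈ X(\overline{K_v})` reduces to a `κ̄(v)`-point `red_𝒳 x` with the same underlying CLOSED point as `z`;
(2) ★ `AlgPoints.preimage_pt_singleton_eq_range` ([GortzWedhorn2020] Prop. 5.4 over `𝔽_q`): the `κ̄(v)`-points of `𝒳_v` over ONE closed point
    form ONE orbit `{φʲ • red_𝒳 x}` of the arithmetic Frobenius `φ ∈ Gal(κ̄(v)/κ(v))`, and `φʲ • P = Fʲ(P)` for the `q`-Frobenius ENDOMORPHISM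
    `F = frobeniusOver 𝒳_v` (★ `arithFrob_pow_smul_eq_iterate_map_frobeniusOver`); so `z = Fʲ(red_𝒳 x)` for some `j`;
(3) ★ `IntegralModel.geomReductionMap_pow_smul_of_isAbsArithFrob` ([SerreTate1968] §1 Lemma 2; the `stub_Fr` file): for an arithmetic Frobenius
    `τ ∈ Γ_{K_v}` (★ `exists_isAbsArithFrob_holds`), `red_𝒳 (τʲ • x) = Fʲ(red_𝒳 x)`.  Hence `z = red_𝒳 (τʲ • x)`.
No surjection `Γ_{K_v} ↠ Gal(κ̄(v)/κ(v))` is used.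

* `exists_geomReductionMap_pow_smul_eq_of_pt_eq` — steps (2)+(3): every `κ̄(v)`-point over the closed point of `red_𝒳 x` is `red_𝒳 (τʲ • x)`
  (PROPER model, no flatness);
* **`geomReductionMap_surjective`** — the head (PROPER FLAT);
* `geomReductionMap_surjective_of_isSmoothProper` — the smooth proper case (smooth ⇒ flat, Mathlib), the shape `𝒮`, `𝒮 ⊗ 𝒮` of the D9op line;
* `properFlatModelReductionSurjective` — the letter `ProperFlatModelReductionSurjective` with its binders.

HC_CM is proved only modulo the 7 printed citations until rung 0 closes; nothing of [Liu2021] is asserted here.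

## References
* [Liu2002] Q. Liu, *Algebraic Geometry and Arithmetic Curves* (OUP 2002), §10.1.3 Prop. 10.1.36, Cor. 10.1.38 (pp. 468–469); Prop. 10.1.40.
* [SerreTate1968] J.-P. Serre, J. Tate, *Good reduction of abelian varieties*, Ann. of Math. 88 (1968), §1 (the reduction map; Lemma 2).
* [GortzWedhorn2020] U. Görtz, T. Wedhorn, *Algebraic Geometry I* (2nd ed. 2020), §(5.2) Prop. 5.4.
* [BoschLutkebohmertRaynaud1990] S. Bosch, W. Lütkebohmert, M. Raynaud, *Néron Models* (1990), §2.3 Prop. 5 (the smooth henselian road, not used).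
-/

set_option autoImplicit false

noncomputable section

open CategoryTheory AlgebraicGeometry IsDedekindDomain IsDedekindDomain.HeightOneSpectrum Field NumberField
open Literature.NumberTheory.GaloisRepresentations (IsAbsArithFrob exists_isAbsArithFrob_holds)
open Literature.NumberTheory.DiophantineGeometry

namespace Literature.AlgebraicGeometry.Motives

namespace IntegralModel

variable {K : Type} [Field K] [NumberField K] {v : HeightOneSpectrum (𝓞 K)} {X : SchemeOver K}

/-- **The Frobenius orbit over a closed point is hit** ([SerreTate1968] §1 Lemma 2 + [GortzWedhorn2020] Prop. 5.4): for a PROPER model `𝒳`,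
an arithmetic Frobenius `τ ∈ Γ_{K_v}`, a point `x ∈ X(\overline{K_v})` and a `κ̄(v)`-point `z` of `𝒳_v` with the same underlying point as
`red_𝒳 x`, there is `j` with `red_𝒳 (τʲ • x) = z` — the `κ̄(v)`-points over one closed point are `{Fʲ (red_𝒳 x)}` and `red_𝒳 (τʲ • x) = Fʲ (red_𝒳 x)`.
[cite: SerreTate1968, §1 Lemma 2] [cite: GortzWedhorn2020, §(5.2) Prop. 5.4] -/
theorem exists_geomReductionMap_pow_smul_eq_of_pt_eq (𝒳 : IntegralModel (valuationSubringAtPrime K v) K X) [IsProper 𝒳.total.hom]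
    {τ : absoluteGaloisGroup (v.adicCompletion K)} (hτ : IsAbsArithFrob τ)
    (x : AlgPoints X (AlgebraicClosure (v.adicCompletion K))) (z : AlgPoints 𝒳.reductionAt (geomResidueField v))
    (h : z.pt = (𝒳.geomReductionMap x).pt) :
    ∃ j : ℕ, 𝒳.geomReductionMap (τ ^ j • x) = z := by
  have hz : z ∈ (AlgPoints.pt : AlgPoints 𝒳.reductionAt (geomResidueField v) → 𝒳.reductionAt.left) ⁻¹'
      {(𝒳.geomReductionMap x).pt} := h
  rw [AlgPoints.preimage_pt_singleton_eq_range] at hz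
  obtain ⟨j, hj⟩ := hz
  refine ⟨j, ?_⟩
  rw [𝒳.geomReductionMap_pow_smul_of_isAbsArithFrob hτ j x, ← arithFrob_pow_smul_eq_iterate_map_frobeniusOver]
  exact hj

/-- **The reduction map of a PROPER FLAT model is surjective** onto the `κ̄(v)`-points of the special fibre ([Liu2002] Cor. 10.1.38 for the
closed points, ★ `exists_geomReductionMap_pt_eq`; then the Frobenius orbit over the closed point, `exists_geomReductionMap_pow_smul_eq_of_pt_eq`
at any arithmetic Frobenius ★ `exists_isAbsArithFrob_holds`).  Flatness is NECESSARY (a component of `𝒳` inside the special fibre is never hit).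
[cite: Liu2002, Cor. 10.1.38] [cite: SerreTate1968, §1 Lemma 2] -/
theorem geomReductionMap_surjective (𝒳 : IntegralModel (valuationSubringAtPrime K v) K X) [IsProper 𝒳.total.hom] [Flat 𝒳.total.hom] :
    Function.Surjective 𝒳.geomReductionMap := by
  intro z
  obtain ⟨x, hx⟩ := 𝒳.exists_geomReductionMap_pt_eq z
  obtain ⟨τ, hτ⟩ : ∃ τ : absoluteGaloisGroup (v.adicCompletion K), IsAbsArithFrob τ := exists_isAbsArithFrob_holds _
  obtain ⟨j, hj⟩ := 𝒳.exists_geomReductionMap_pow_smul_eq_of_pt_eq hτ x z hx.symm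
  exact ⟨τ ^ j • x, hj⟩

/-- Every `κ̄(v)`-point of the special fibre of a proper flat model is a reduction: `Set.range red_𝒳 = univ`. [cite: Liu2002, Cor. 10.1.38] -/
theorem range_geomReductionMap (𝒳 : IntegralModel (valuationSubringAtPrime K v) K X) [IsProper 𝒳.total.hom] [Flat 𝒳.total.hom] :
    Set.range 𝒳.geomReductionMap = Set.univ :=
  𝒳.geomReductionMap_surjective.range_eq

/-- **The smooth proper case** (the curve model `𝒮` and `𝒮 ⊗ 𝒮` of the D9op line): the reduction map of a model that is smooth of some relative
dimension and proper is surjective (smooth ⇒ flat, Mathlib). [cite: Liu2002, Cor. 10.1.38 and Prop. 10.1.40] [cite: SerreTate1968, §1 Lemma 2] -/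
theorem geomReductionMap_surjective_of_isSmoothProper (𝒳 : IntegralModel (valuationSubringAtPrime K v) K X) {d : ℕ}
    (h𝒳 : 𝒳.IsSmoothProper d) :
    haveI := h𝒳.2
    Function.Surjective 𝒳.geomReductionMap := by
  haveI := h𝒳.1
  haveI := h𝒳.2
  haveI : Smooth 𝒳.total.hom := SmoothOfRelativeDimension.smooth d _
  exact 𝒳.geomReductionMap_surjective

end IntegralModel

/-- **LETTER H — `ProperFlatModelReductionSurjective` HOLDS** (the registered letter `stub_H` of `F0_D9opRoad2` ed. 4, binders token for token):
for every number field `K`, finite place `v`, `K`-scheme `X` and proper flat integral model `𝒳` of `X` over `𝓞_{K,(v)}`, `red_𝒳` is surjective.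
[cite: Liu2002, Prop. 10.1.36 and Cor. 10.1.38 (p. 468–469)] [cite: SerreTate1968, §1 (the reduction map)] -/
theorem properFlatModelReductionSurjective :
    ∀ (K : Type) [Field K] [NumberField K] (v : HeightOneSpectrum (𝓞 K)) (X : SchemeOver K)
      (𝒳 : IntegralModel (valuationSubringAtPrime K v) K X) [IsProper 𝒳.total.hom] [Flat 𝒳.total.hom],
      Function.Surjective 𝒳.geomReductionMap :=
  fun _ _ _ _ _ 𝒳 _ _ => 𝒳.geomReductionMap_surjective

end Literature.AlgebraicGeometry.Motives

end
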